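import Literature.Computability.QuantumComplexity.RazTalMaskedMachine
import Literature.Computability.QuantumComplexity.RazTalMachineUniform
import HarnessLib

/-!
# The Raz–Tal `BQP^O` machine on an XOR-masked window, III: uniformity

Sequel of `RazTalMaskedMachine.lean` and variant of `RazTalMachineUniform.lean`: the masked
family `rtFamilyM n₀ tbl` is polynomial-time uniform (`rtFamilyM_isUniform`), by the same
generator-program argument (Arora–Barak 2009, §6.2 and proof of Thm. 6.15: "output the description
gate by gate, keeping counters") — the generator `descGM` differs from `descG` only in the quantum
segment of each block (two oracle queries with the seed wire appended, and the two `NOT`s), and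
the pre-processing, header, token steps and read-out generators are reused. Whence
**`razTalMasked_bqpMachine`**: the uniform `BQP^O` family running Raz–Tal's `Q₁` on the masked
level-`n` window `mWindow O n` — the quantum side of the algebraic oracle separation
`BQP^A ⊄ BPP^Ã` (Aaronson–Wigderson, Thm. 5.11 (v)).

## References

* R. Raz, A. Tal, *Oracle separation of BQP and PH*, J. ACM 69 (2022), App. A [RazTalJACM2022].
* S. Aaronson, A. Wigderson, *Algebrization: a new barrier in complexity theory*, STOC 2008 (full
  version), Thm. 5.11 (v) [AaronsonWigderson2008].
* S. Arora, B. Barak, *Computational Complexity: A Modern Approach*, CUP 2009, §6.2, Thm. 6.15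
  (proof) [AroraBarak2009].
-/

namespace Literature.Computability.QuantumComplexity

open _root_.Computability Complexity Cryptography RevDesc RevSim
open Complexity.SProg (dbl dbl_nil dbl_cons)

namespace RazTalMachine

/-- **The description of the masked big circuit is the concatenation of the `RtOp.bits` of `allOpsM`.**
[Arora–Barak 2009, §6.1] [folklore] -/
theorem encode_bigCircM (n : ℕ) : QCircuit.encode (bigCircM n) = (allOpsM n).flatMap RtOp.bits := by
  rw [bigCircM, encode_eq_flatMap]
  exact flatMap_gateEnc_compileList rtW_pos (allOpsM n) allOpsM_lt _

namespace RtGen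

attribute [local simp] GExpr.eval

/-- **the masked oracle query of the current block** (query wires: address, index bits, seed).
[cite: AaronsonWigderson2008, Thm. 5.11 (v)] -/
def oracleGM : GS :=
  .seq (.emit (litT [true, true]))
  (.seq (ticksG (.add (.add nE (.const 2)) LE))
  (.seq (.emit (Tok.dump true true :: litT [false, false, true, true]))
  (.seq (.loop .cc (.mul (.const 4) (.add (.add (.add nE (.const 2)) LE) (.const 1))) (.emit [Tok.lit true]))
  (.seq (.emit (litT [false, false, true, true]))
  (.seq (.loop .ll (.add nE (.const 1)) (wireG (sh (.var .ll))))
  (.seq (.loop .ll LE (wireG (sh (bWL (.var .ll)))))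
  (.seq (wireG (sh oWL))
  (.seq (wireG (sh tWL)) (.emit (litT [false, true]))))))))))

/-- **one masked block** (`blockOpsM` shifted to the current block). [folklore] -/
def blockGM : GS :=
  .seq (opG (ClOp.not (sh oWL)))
  (.seq (.loop .rr (.var .bi) incrG)
  (.seq (opG (ClOp.not (sh tWL)))
  (.seq (hadG (sh tWL))
  (.seq (.loop .ll (.add nE (.const 1)) (hadG (sh (.var .ll))))
  (.seq oracleGM
  (.seq (opG (ClOp.not (sh oWL)))
  (.seq oracleGM
  (.seq (opG (ClOp.not (sh oWL)))
  (.seq (.loop .ll nE (chadG (sh nE) (sh (.var .ll))))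
    (hadG (sh nE)))))))))))

/-- **The generator program of the masked Raz–Tal family** (big circuits). [Arora–Barak 2009, §6.2 and proof of Thm. 6.15] [folklore] -/
def descGM : GS :=
  .seq headerG (.seq preG (.seq (.loop .bi mE blockGM) postG))

variable {env : RV → ℕ}

/-- **The masked oracle generator prints the shifted masked oracle query.** [folklore] -/
theorem out_oracleGM (hL : env .xL = rtL (env .xn)) :
    oracleGM.out env = (RtOp.oracle ((queryWiresM (env .xn) (env .xL)).map (· + blkBase (env .xn) (env .bi)))
      (tW (env .xn) + blkBase (env .xn) (env .bi))).toks := by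
  have hxl : ∀ j, Function.update env RV.ll j RV.xn = env .xn := fun j => by simp
  have hLl : ∀ j, Function.update env RV.ll j RV.xL = env .xL := fun j => by simp
  have hblk : ∀ j, (blkE (.var .bi)).eval (Function.update env .ll j) = blkBase (env .xn) (env .bi) := fun j => by
    rw [eval_blkE _ _ (by rw [hLl, hxl]; exact hL)]; simp
  have hblk0 : (blkE (.var .bi)).eval env = blkBase (env .xn) (env .bi) := by rw [eval_blkE _ _ hL]; simp
  simp only [oracleGM, GStmt.out, out_ticksG, out_wireG, GExpr.eval, nE, LE, sh, hxl, Function.update_self, hblk, hblk0,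
    eval_bWL, eval_tWL, eval_oWL, flatMap_range_const, RtOp.toks, oracleToks, queryWiresM, queryWires, List.length_map,
    List.length_append, List.length_range, List.length_singleton, List.map_append, List.map_map, List.flatMap_append,
    List.flatMap_map, List.append_assoc, List.cons_append, List.map_cons, List.map_nil]
  simp [litT]
  ring_nf

/-- **The masked block generator prints the shifted masked block program.** [folklore] -/
theorem out_blockGM (hL : env .xL = rtL (env .xn)) :
    blockGM.out env = ((blockOpsM (env .xn) (env .xL) (env .bi)).map (RtOp.map (· + blkBase (env .xn) (env .bi)))).flatMap
      RtOp.toks := by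
  have hxr : ∀ j, Function.update env RV.rr j RV.xn = env .xn := fun j => by simp
  have hLr : ∀ j, Function.update env RV.rr j RV.xL = env .xL := fun j => by simp
  have hbr : ∀ j, Function.update env RV.rr j RV.bi = env .bi := fun j => by simp
  have hxl : ∀ j, Function.update env RV.ll j RV.xn = env .xn := fun j => by simp
  have hLl : ∀ j, Function.update env RV.ll j RV.xL = env .xL := fun j => by simp
  have hblk : ∀ j, (blkE (.var .bi)).eval (Function.update env .ll j) = blkBase (env .xn) (env .bi) := fun j => by
    rw [eval_blkE _ _ (by rw [hLl, hxl]; exact hL)]; simp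
  have hblk0 : (blkE (.var .bi)).eval env = blkBase (env .xn) (env .bi) := by rw [eval_blkE _ _ hL]; simp
  have hinc : ∀ k, incrG.out (Function.update env .rr k) = (incrOps (env .xn) (env .xL) k).flatMap
      fun op => (RtOp.cl (op.map (· + blkBase (env .xn) (env .bi)))).toks := fun k => by
    rw [out_incrG (by rw [hLr, hxr]; exact hL)]; simp
  simp only [blockGM, GStmt.out, out_opG, out_hadG, out_chadG, hinc, out_oracleGM hL, GExpr.eval, nE, sh, hxl,
    Function.update_self, hblk, hblk0, eval_tWL, blockOpsM, prefixOps, quantOpsM, List.map_append, List.map_cons,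
    List.map_map, List.flatMap_append, List.flatMap_cons, List.flatMap_map, List.map_flatMap, List.flatMap_assoc,
    List.append_assoc, List.nil_append, List.cons_append, List.flatMap_nil, List.map_nil]
  simp [hW, hblk0]

/-- **The masked generator prints the header followed by the tokens of the whole masked program.** [folklore] -/
theorem out_descGM (n : ℕ) :
    descGM.out (GenProg.initEnv₂ .xn .xL n (rtL n)) = headerToks n (rtAnc n) ++ (allOpsM n).flatMap RtOp.toks := by
  set env₀ := GenProg.initEnv₂ RV.xn RV.xL n (rtL n) with henv
  have hn : env₀ .xn = n := by simp [henv, GenProg.initEnv₂]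
  have hLv : env₀ .xL = rtL n := by simp [henv, GenProg.initEnv₂]
  have hL : env₀ .xL = rtL (env₀ .xn) := by rw [hn, hLv]
  have hxb : ∀ j, Function.update env₀ RV.bi j RV.xn = n := fun j => by simp [hn]
  have hLb : ∀ j, Function.update env₀ RV.bi j RV.xL = rtL n := fun j => by simp [hLv]
  have hblk : ∀ j, blockGM.out (Function.update env₀ .bi j) =
      ((blockOpsM n (rtL n) j).map (RtOp.map (· + blkBase n j))).flatMap RtOp.toks := fun j => by
    rw [out_blockGM (by rw [hLb, hxb])]; simp [hn, hLv]
  simp only [descGM, GStmt.out, out_headerG hL, out_preG, out_postG hL, hn, eval_mE, hblk, allOpsM, blocksOpsM,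
    List.flatMap_append]
  rw [List.flatMap_assoc]

/-- **The masked generator renders the description of the masked big circuit.**
[Arora–Barak 2009, §6.2 and proof of Thm. 6.15] [folklore] -/
theorem render_out_descGM (n : ℕ) :
    Tok.render 0 (descGM.out (GenProg.initEnv₂ .xn .xL n (rtL n))) = QCircuit.sigmaEncode ⟨n, rtAnc n, bigCircM n⟩ := by
  rw [out_descGM, render_headerToks, ← List.append_nil ((allOpsM n).flatMap RtOp.toks), render_flatMap_rtoks, Tok.render_nil,
    List.append_nil, ← encode_bigCircM]
  change _ = boolPair (encodeNat n) (boolPair (unaryEncodeNat (rtAnc n)) (QCircuit.encode (bigCircM n)))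
  rw [boolPair_eq, boolPair_eq, RevDesc.unaryEncodeNat_eq_replicate, dbl_replicate]
  simp

/-- The input variable `xn` is not a loop variable of the masked generator. [folklore] -/
theorem xn_not_mem_loopVars_descGM : RV.xn ∉ descGM.loopVars := by decide

/-- The input variable `xL` is not a loop variable of the masked generator. [folklore] -/
theorem xL_not_mem_loopVars_descGM : RV.xL ∉ descGM.loopVars := by decide

/-- The masked generator does not reuse loop variables. [folklore] -/
theorem noReuse_descGM : descGM.noReuse = true := by decide

/-- **The description of the masked big circuits is in `FP`.** [Arora–Barak 2009, §6.2 and proof of Thm. 6.15] [folklore] -/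
theorem descBigM_mem_FP :
    (fun z : List Bool => QCircuit.sigmaEncode (G := cliffordT) ⟨z.length, rtAnc z.length, bigCircM z.length⟩) ∈ FP := by
  have hpre := GStmt.render_out_mem_FP pre1G .xn pre1G_hygiene.1 pre1G_hygiene.2
  have hgen := GStmt.render_out₂_mem_FP descGM .xn .xL xn_not_mem_loopVars_descGM xL_not_mem_loopVars_descGM noReuse_descGM
  have h := comp_mem_FP hgen hpre
  have e : ((fun w => Tok.render 0 (descGM.out (GenProg.parseEnv RV.xn RV.xL (fun _ => 0) w))) ∘ fun z : List Bool =>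
      Tok.render 0 (pre1G.out (GenProg.initEnv RV.xn z.length))) =
      fun z : List Bool => QCircuit.sigmaEncode (G := cliffordT) ⟨z.length, rtAnc z.length, bigCircM z.length⟩ := by
    funext z
    simp only [Function.comp_apply]
    rw [render_out_pre1G, GenProg.parseEnv_replicate (by decide), TM2Pass.length_encodeNat_eq_size]
    exact render_out_descGM z.length
  rwa [e] at h

end RtGen

open RtGen in
/-- **The masked Raz–Tal family is polynomial-time uniform.** [cite: RazTalJACM2022, App. A] -/
theorem rtFamilyM_isUniform (n₀ : ℕ) (tbl : ℕ → Bool) : (rtFamilyM n₀ tbl).IsUniform := by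
  refine QCircuitFamily.isUniform_of_mem_FP _ (mem_FP_of_eqOn_le descBigM_mem_FP n₀ fun z hz => ?_)
  simp [rtFamilyM, not_lt.2 hz]

end RazTalMachine

open RazTalMachine in
/-- **The uniform `BQP^O` machine running Raz–Tal's `Q₁` on the XOR-masked window** (the quantum side
of Aaronson–Wigderson's Thm. 5.11 (v), in H21's `BQPRel` model): for every threshold `n₀` and table
`tbl`, a polynomial-time uniform family of Clifford+T circuits with oracle gates which accepts `x`
with probability `tbl |x|` below `n₀` and with probability exactly `q1Accept |x| (mWindow O |x|)`
from `n₀` on — `m(n)` masked blocks (two phase queries each, at `rtAddr n i k ++ [0]` and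
`rtAddr n i k ++ [1]`), reversible threshold count, generator-program uniformity.
[cite: RazTalJACM2022, App. A] [cite: AaronsonWigderson2008, Thm. 5.11 (v)] -/
theorem razTalMasked_bqpMachine (n₀ : ℕ) (tbl : ℕ → Bool) :
    ∃ F : QCircuitFamily cliffordT, F.IsUniform ∧
      ∀ (A : Language Bool) (x : List Bool),
        (x.length < n₀ → F.acceptProbOn A x = if tbl x.length then 1 else 0) ∧
        (n₀ ≤ x.length → F.acceptProbOn A x = q1Accept x.length (mWindow A x.length)) :=
  maskedMachine_of_isUniform rtFamilyM_isUniform n₀ tbl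

end Literature.Computability.QuantumComplexity
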